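import Literature.MathematicalPhysics.QuantumFieldTheory.ConformalBootstrap3D.PointKernelK34v2Data

/-!
# K34v2 certificate, kernel block file H10: head segments `184 ≤ i < 199` (block-checked ones)

`decide` by kernel reduction (no `native_decide`, no extra axioms) of the block checker
`PCert.hBlockOK` of `PointKernel` on the literal data of `PointKernelK34v2Data` (cells checked corner
or chord by the rule bit); soundness is `PCert.hBlockOK_sound`.  Estimated kernel time 217 s
(5 theorems).
-/

set_option maxRecDepth 100000
set_option maxHeartbeats 0

namespace Literature.MathematicalPhysics.QuantumFieldTheory.ConformalBootstrap3D.PointKernelK34v2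

open Literature.MathematicalPhysics.QuantumFieldTheory.ConformalBootstrap3D.PointKernel

/-- head segment `[184, 185)` passes the kernel evaluator (≈45 s of kernel work). [folklore] -/
theorem hBlock_184 : certK34v2.hBlockOK hsegsK34v2 184 185 JHK34v2 = true := by
  decide +kernel

/-- head segment `[194, 195)` passes the kernel evaluator (≈38 s of kernel work). [folklore] -/
theorem hBlock_194 : certK34v2.hBlockOK hsegsK34v2 194 195 JHK34v2 = true := by
  decide +kernel

/-- head segments `[195, 197)` pass the kernel evaluator (≈46 s of kernel work). [folklore] -/
theorem hBlock_195 : certK34v2.hBlockOK hsegsK34v2 195 197 JHK34v2 = true := by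
  decide +kernel

/-- head segment `[197, 198)` passes the kernel evaluator (≈27 s of kernel work). [folklore] -/
theorem hBlock_197 : certK34v2.hBlockOK hsegsK34v2 197 198 JHK34v2 = true := by
  decide +kernel

/-- head segment `[198, 199)` passes the kernel evaluator (≈43 s of kernel work). [folklore] -/
theorem hBlock_198 : certK34v2.hBlockOK hsegsK34v2 198 199 JHK34v2 = true := by
  decide +kernel

end Literature.MathematicalPhysics.QuantumFieldTheory.ConformalBootstrap3D.PointKernelK34v2
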